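import Summits.QuantumFields.BalabanUV.Beta.GAN24.T2HybridShapeEnd
import Summits.QuantumFields.BalabanUV.Beta.GAN24.T2DevConservationDriftRows
import Summits.QuantumFields.BalabanUV.Beta.GAN24.KSlotAssembly
import Summits.QuantumFields.BalabanUV.Beta.GAN24.T2UnitSplitFrom

/-!
# `BalabanUV.Beta.GAN24.T2HybridDriftEnd` — binder row G-an2-4 ∕ (CONV-C), CT-W (RULING R-gan24p1-g22-1 «HYB-END» ∕ R-gan24p1-g23-1 (R-HYB′)): **THE `d = 3` HYB′ DRIFT
# SOCKET — the drift twin of the OWNER gan24-p1 g23's `T2HybridShapeEnd.shape_three_of_hyb_rows`, for ANY tower `T_{n+1} = 𝒜^B_n T_n + b_n` with sources RELATIVE to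
# road W3's undressed step**: «T2Drift» ⟸ «T2Shape» ∧ the sources' rows `hb ∕ hZ` (the shape socket's, VERBATIM) ∧ ONE NEW ROW `hbd` (the sources' one-step rate) ∧ the
# EXACT pin `cE₂ = Lc⁸` (road-P2 chair of row G-an2-4, unit `b2b-balaban-gan24-p2` gen 45, crux team (2); [GAN24P2-G45-INTENT4] FILE 1 — the `ε`-member INSTANCE is the OWNER
# gan24-p1 g34's `T2DriftEvenEnd` (his INTENT 1; our lines crossed, his file is the instance of record), this file is the GENERIC socket for other splittings)

NOT IN PRINT; OUR BOOKKEEPING ([folklore] composition BY NAME; 0 `def`, 0 cited facts, 0 `def … : Prop`, 0 sorry).  HONEST FRAMING (cell contract, verbatim): «discharging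
`BetaPertH` makes Bałaban's UV stability UNCONDITIONAL — a real constructive-QFT result; it is NOT the continuum limit and NOT the Clay problem.»  HONEST DEPENDENCY (verbatim):
«continuum YM on T⁴ ⇐ BetaPertH ∧ nine spine estimates (0/9 proved); BetaPertH ⇐ (D1) ∧ (D4) ∧ CAP+tail; G-an2-4 gates asym, D1 and NE2/3/4.»

WHAT.  `𝒜^B_j := lin4 (cE₂·Lc⁸) (unitK_j (KInvStep Lc j)) Lc` (road W3's undressed unit step), `T b : ℕ → BiTab 3` with `hstep : T (n+1) = 𝒜^B_n (T n) + b n`.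
* §1 `zsym_lin4_step_of_pinEq` — AT THE EXACT PIN `cE₂ = Lc⁸` THE UNDRESSED STEP CONSERVES THE BOND-SYMMETRISED ff CELL CHARGE of every jointly covariant `LocStencil₂` table
  (leaf-18's `Lin4ZeroMode.zmode_lin4_step`: the `j`-free eigenvalue is `1`); `cov_of_step` — joint `Lc`-covariance propagates along the tower.
* §2 **`drift_three_of_hyb_rows`** (`2 ≤ Lc`, exact pin; rows: «T2Shape» `hT : ∀ n, LocStencil₂ (T n) C₂ δin`, member-0 covariance `h0cov`, `hb ∕ hZ` as in the shape socket,
  **`hbd : ∀ n, LocStencil₂ (b (n+1) − b n) (cb·θb^n) δin`**, `0 ≤ θb < 1`): `∃ c ϑ δ, 0 ≤ c ∧ 0 < ϑ ∧ ϑ < 1 ∧ 0 < δ ∧ (∀ n, LocStencil₂ (T (n+1) − T n) (c·ϑ^n) δ) ∧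
  (∀ k j, LocStencil₂ (T (k+j) − T k) (c·(1−ϑ)⁻¹·ϑ^k) δ)`.  MECHANISM: the one-step differences `D_n` obey `D_{n+1} = 𝒜^B_{n+1} D_n + f_n`,
  `f_n = (𝒜^B_{n+1} − 𝒜^B_n) T_n + (b_{n+1} − b_n)` — geometric by road P1's K-Cauchy pair (`convCKWall_holds`) × «T2Shape» + `hbd` (leaf-01 g63's `exists_forcing_rate`) and
  `ZfreeSym` with NO charge hypothesis on `T_n` (`zfreeSym_forcing`); `D_0 = (𝒜^B_0 − 1) T_0 + b_0` is `ZfreeSym` by §1 — the one place the EXACT pin (not `|cE₂| ≤ Lc⁸`) enters;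
  unrolled by leaf-01's `AffineUnroll.diff_eq_transport_add_sum` on the bounded class through the SHIFTED transport, which leaf-10∕12's `TransportRows.transport_rows_three_symZ`
  controls at any start index; then road W3's END #2 `WSlotT2OfPieces.rate_of_rows` (`mom := 0`) and `cauchy_of_rate`.
WHY `hbd` AND NOT `b_n → 0`: in HYB′ currency `b_n → (1 − 𝒜^B_∞) T_∞ ≠ 0`; only the sources' DIFFERENCES must decay.  Discharges NOTHING of «T2Shape» ∕ «T2Drift» ∕ (hW, hWall)
at any literal; the rows are displayed; NEVER «G-an2-4 closed» as (CONV-C); NOT D1, NOT `BetaPertH`, NOT continuum, NOT Clay; not in print — our bookkeeping.  2026-08-23.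
-/

noncomputable section

open Finset
open scoped BigOperators
open Literature.MathematicalPhysics.QuantumFieldTheory
open Literature.MathematicalPhysics.QuantumFieldTheory.Balaban1983to89
open Literature.MathematicalPhysics.QuantumFieldTheory.Balaban1983to89.Beta
open ExpKernelCalculus (MKer Decays shiftK)
open OneStepResolventKernel (Fib LocStencil decays_mono)
open OneStepKernelFamily (KInvStep)
open BalabanCompositeJets (LocStencil₂ LocStencil₂.nonneg LocStencil₂.mono)
open Summit.QuantumFields.BalabanUV.Beta.HessKerDressedUnits (unitK)
open Summit.QuantumFields.BalabanUV.Beta.GAN24.CombesThomas (sfStep smStep UnitDecayK CauchyDecayK)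
open Summit.QuantumFields.BalabanUV.Beta.GAN24.KSlotAssembly (convCKWall_holds)
open Summit.QuantumFields.BalabanUV.Beta.GAN24.Push4Iter (BiTab)
open Summit.QuantumFields.BalabanUV.Beta.GAN24.T2RecursionAffine (lin4)
open Summit.QuantumFields.BalabanUV.Beta.GAN24.AffineUnroll (transport diff_eq_transport_add_sum)
open Summit.QuantumFields.BalabanUV.Beta.GAN24.BiStencilZeroMode (zmode)
open Summit.QuantumFields.BalabanUV.Beta.GAN24.WSlotFirstDiff (zmode_add zmode_sub)
open Summit.QuantumFields.BalabanUV.Beta.GAN24.WSlotForcingZeroMode (locStencil₂_sub)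
open Summit.QuantumFields.BalabanUV.Beta.GAN24.WSlotForcingZeroModeW3 (sub_translate_pi add_translate_pi)
open Summit.QuantumFields.BalabanUV.Beta.GAN24.WSlotT2OfPieces (rate_of_rows cauchy_of_rate locStencil₂_add locStencil₂_mono)
open Summit.QuantumFields.BalabanUV.Beta.GAN24.WSlotCauchyOfShapes (locStencil₂_le_mono)
open Summit.QuantumFields.BalabanUV.Beta.GAN24.TransportRows (transport_rows_three_symZ inv_natCast_nonneg inv_natCast_lt_one)
open Summit.QuantumFields.BalabanUV.Beta.GAN24.T2UnitSplitLevels (bdd₄_zero bdd₄_add bdd₄_sub)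
open Summit.QuantumFields.BalabanUV.Beta.GAN24.T2UnitSplitShapes (bdd₄_of_locStencil₂)
open Summit.QuantumFields.BalabanUV.Beta.GAN24.T2UnitSplitFrom (lin4_bdd₄ lin4_add_bdd₄)
open Summit.QuantumFields.BalabanUV.Beta.GAN24.Lin4ZeroMode (lin4_translate shiftK_unitKInvStep zmode_lin4_step locStencil₂_lin4)
open Summit.QuantumFields.BalabanUV.Beta.GAN24.T2DevConservationDriftRows (zfreeSym_add zfreeSym_sub zfreeSym_forcing exists_forcing_rate)

namespace Summit.QuantumFields.BalabanUV.Beta.GAN24.T2HybridDriftEnd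

variable {Lc : ℕ} [NeZero Lc]

/-! ## §1 At the exact pin the undressed step conserves the bond-symmetrised ff cell charge; covariance along the tower -/

/-- [folklore] **AT THE EXACT PIN `cE₂ = Lc⁸` THE UNDRESSED STEP `𝒜^B_j` CONSERVES THE BOND-SYMMETRISED ff CELL CHARGE EXACTLY** (`d = 3`, every `j`, every jointly
`Lc`-covariant `LocStencil₂` table `X`, `δ > 0`): `zsym (𝒜^B_j X) = zsym X` — leaf-18's `Lin4ZeroMode.zmode_lin4_step` (`zmode_Lc (𝒜^B_j X) κκ′ = Lc^4·(c₄·½·Lc^{−20})·zsym X`) at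
`c₄ = Lc⁸·Lc⁸`; the `j`-free eigenvalue is `1`. -/
theorem zsym_lin4_step_of_pinEq (hLc : 1 ≤ Lc) {cE₂ : ℝ} (hpinEq : cE₂ = (Lc : ℝ) ^ (2 * (3 + 1))) (j : ℕ) {X : BiTab 3} {CT δ : ℝ}
    (hX : LocStencil₂ X CT δ) (hδ : 0 < δ)
    (hXcov : ∀ κ u κ' u' t, X κ (u + (Lc : ℤ) • t) κ' (u' + (Lc : ℤ) • t) = shiftK (-((Lc : ℤ) • t)) (X κ u κ' u')) (κ κ' κ₁ κ₂ : Fin (3 + 1)) :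
    zmode Lc (lin4 (cE₂ * (Lc : ℝ) ^ (2 * (3 + 1))) (unitK (sfStep Lc j) (smStep 3 Lc j) (KInvStep (d := 3) Lc j)) Lc X) κ κ' (Sum.inl κ₁) (Sum.inl κ₂)
      + zmode Lc (lin4 (cE₂ * (Lc : ℝ) ^ (2 * (3 + 1))) (unitK (sfStep Lc j) (smStep 3 Lc j) (KInvStep (d := 3) Lc j)) Lc X) κ' κ (Sum.inl κ₁) (Sum.inl κ₂)
      = zmode Lc X κ κ' (Sum.inl κ₁) (Sum.inl κ₂) + zmode Lc X κ' κ (Sum.inl κ₁) (Sum.inl κ₂) := by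
  rw [zmode_lin4_step hLc Lc j _ hX hδ hXcov κ κ' κ₁ κ₂, zmode_lin4_step hLc Lc j _ hX hδ hXcov κ' κ κ₁ κ₂, hpinEq]
  have hL : (Lc : ℝ) ≠ 0 := Nat.cast_ne_zero.mpr (NeZero.ne Lc)
  field_simp
  ring

/-- [folklore] **JOINT `Lc`-COVARIANCE PROPAGATES ALONG THE HYB′ TOWER** `T_{n+1} = 𝒜^B_n T_n + b_n` from member 0 and the sources (leaf-18's `lin4_translate` on the
block-covariant `K♮_n`, `add_translate_pi`). -/
theorem cov_of_step (cE₂ : ℝ) {T b : ℕ → BiTab 3}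
    (hstep : ∀ n, T (n + 1) = lin4 (cE₂ * (Lc : ℝ) ^ (2 * (3 + 1))) (unitK (sfStep Lc n) (smStep 3 Lc n) (KInvStep (d := 3) Lc n)) Lc (T n) + b n)
    (h0cov : ∀ κ u κ' u' t, T 0 κ (u + (Lc : ℤ) • t) κ' (u' + (Lc : ℤ) • t) = shiftK (-((Lc : ℤ) • t)) (T 0 κ u κ' u'))
    (hbcov : ∀ n κ u κ' u' t, b n κ (u + (Lc : ℤ) • t) κ' (u' + (Lc : ℤ) • t) = shiftK (-((Lc : ℤ) • t)) (b n κ u κ' u')) :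
    ∀ n κ u κ' u' t, T n κ (u + (Lc : ℤ) • t) κ' (u' + (Lc : ℤ) • t) = shiftK (-((Lc : ℤ) • t)) (T n κ u κ' u') := by
  intro n
  induction n with
  | zero => exact h0cov
  | succ n ih =>
      intro κ u κ' u' t
      rw [hstep n]
      exact add_translate_pi (w := (Lc : ℤ) • t) (v := -((Lc : ℤ) • t))
        (fun κ u κ' u' => lin4_translate (shiftK_unitKInvStep n) _ ih κ u κ' u' ((Lc : ℤ) • t)) (fun κ u κ' u' => hbcov n κ u κ' u' t) κ u κ' u'

/-! ## §2 The `d = 3` HYB′ DRIFT SOCKET -/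

/-- NOT IN PRINT; OUR BOOKKEEPING ([folklore] composition BY NAME: leaf-01's `AffineUnroll.diff_eq_transport_add_sum` on the bounded class, leaf-01 g63's
`T2DevConservationDriftRows.exists_forcing_rate` ∕ `zfreeSym_forcing`, leaf-10∕12's `TransportRows.transport_rows_three_symZ` (any start index), road W3's END #2
`WSlotT2OfPieces.rate_of_rows` ⨾ `cauchy_of_rate`, §1; the K-slot's uniform ∕ Cauchy pair by road P1's `convCKWall_holds`).  **THE DRIFT TWIN OF `T2HybridShapeEnd.shape_three_of_hyb_rows`.**
Let `T b : ℕ → BiTab 3` with the HYB′ one-step law `T (n+1) = 𝒜^B_n (T n) + b n` (`𝒜^B_n = lin4 (cE₂·Lc⁸) K♮_n Lc`, `b` = the source RELATIVE to the undressed step), at the EXACT pin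
`cE₂ = Lc⁸`, `2 ≤ Lc`.  If «T2Shape» holds (`∀ n, LocStencil₂ (T n) C₂ δin` — the shape END's output), member 0 is jointly `Lc`-covariant, the sources are uniformly `LocStencil₂`,
`ZfreeSym` (jointly covariant ∧ vanishing bond-symmetrised ff cell charge — the shape socket's `hb ∕ hZ` VERBATIM) AND HAVE A GEOMETRIC ONE-STEP RATE
`hbd : ∀ n, LocStencil₂ (b (n+1) − b n) (cb·θb^n) δin` (`0 ≤ θb < 1`), then «T2Drift»:
`∃ c ϑ δ, 0 ≤ c ∧ 0 < ϑ ∧ ϑ < 1 ∧ 0 < δ ∧ (∀ n, LocStencil₂ (T (n+1) − T n) (c·ϑ^n) δ) ∧ (∀ k j, LocStencil₂ (T (k+j) − T k) (c·(1−ϑ)⁻¹·ϑ^k) δ)`.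
MECHANISM: `D_n := T_{n+1} − T_n` obeys `D_{n+1} = 𝒜^B_{n+1} D_n + f_n`, `f_n = (𝒜^B_{n+1} − 𝒜^B_n) T_n + (b_{n+1} − b_n)` — geometric (K Cauchy ∧ «T2Shape» ∧ `hbd`) and `ZfreeSym`
(NO charge hypothesis on `T_n`); `D_0 = (𝒜^B_0 − 1) T_0 + b_0` is `ZfreeSym` because the undressed step CONSERVES the symmetrised charge at the exact pin (§1) — this is where
`cE₂ = Lc⁸` (not `|cE₂| ≤ Lc⁸`) enters; transport is irrelevant on `ZfreeSym` tables with gain `Lc⁻¹` per step.  ONLY the rows are displayed; discharges NOTHING of «T2Shape» ∕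
«T2Drift» ∕ (hW, hWall) at any literal; NEVER «G-an2-4 closed» as (CONV-C). -/
theorem drift_three_of_hyb_rows (hLc : 2 ≤ Lc) {cE₂ : ℝ} (hpinEq : cE₂ = (Lc : ℝ) ^ (2 * (3 + 1))) (T b : ℕ → BiTab 3) {C₂ Cb cb θb δin : ℝ}
    (hδin : 0 < δin)
    (hstep : ∀ n, T (n + 1) = lin4 (cE₂ * (Lc : ℝ) ^ (2 * (3 + 1))) (unitK (sfStep Lc n) (smStep 3 Lc n) (KInvStep (d := 3) Lc n)) Lc (T n) + b n)
    (hT : ∀ n, LocStencil₂ (T n) C₂ δin)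
    (h0cov : ∀ κ u κ' u' t, T 0 κ (u + (Lc : ℤ) • t) κ' (u' + (Lc : ℤ) • t) = shiftK (-((Lc : ℤ) • t)) (T 0 κ u κ' u'))
    (hb : ∀ n, LocStencil₂ (b n) Cb δin)
    (hZ : ∀ n, (∀ κ u κ' u' t, b n κ (u + (Lc : ℤ) • t) κ' (u' + (Lc : ℤ) • t) = shiftK (-((Lc : ℤ) • t)) (b n κ u κ' u')) ∧
      (∀ κ κ' κ₁ κ₂, zmode Lc (b n) κ κ' (Sum.inl κ₁) (Sum.inl κ₂) + zmode Lc (b n) κ' κ (Sum.inl κ₁) (Sum.inl κ₂) = 0))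
    (hbd : ∀ n, LocStencil₂ (b (n + 1) - b n) (cb * θb ^ n) δin) (hθb0 : 0 ≤ θb) (hθb1 : θb < 1) :
    ∃ c ϑ δ : ℝ, 0 ≤ c ∧ 0 < ϑ ∧ ϑ < 1 ∧ 0 < δ ∧
      (∀ n, LocStencil₂ (fun κ u κ' u' => T (n + 1) κ u κ' u' - T n κ u κ' u') (c * ϑ ^ n) δ) ∧
      (∀ k j, LocStencil₂ (fun κ u κ' u' => T (k + j) κ u κ' u' - T k κ u κ' u') (c * (1 - ϑ)⁻¹ * ϑ ^ k) δ) := by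
  have hLc1 : 1 ≤ Lc := le_trans (by norm_num) hLc
  have hpin : |cE₂| ≤ (Lc : ℝ) ^ (2 * (3 + 1)) := by rw [hpinEq, abs_of_nonneg (by positivity)]
  -- road P1's K-pair
  obtain ⟨CK, δK, cK, θK, hδK, hθK0, hθK1, hK, hKc⟩ := convCKWall_holds (Lc := Lc) hLc
  have hCK : 0 ≤ CK := (hK 0).nonneg (Sum.inl 0)
  have hC₂ : 0 ≤ C₂ := (hT 0).nonneg
  have hCb : 0 ≤ Cb := (hb 0).nonneg
  -- covariance of every member
  have hTcov := cov_of_step cE₂ hstep h0cov (fun n => (hZ n).1)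
  -- the forcing: geometric rate and zero-mode-freeness
  obtain ⟨Cf, θf, δf, hCf, hθf0, hθf1, hδf, hf⟩ := exists_forcing_rate (d := 3) hLc1 (cE₂ * (Lc : ℝ) ^ (2 * (3 + 1))) T b hK hKc hδK hθK0 hθK1
    hT hδin hbd hθb0 hθb1 hδin
  have hZf : ∀ m, (∀ κ u κ' u' t, ((lin4 (cE₂ * (Lc : ℝ) ^ (2 * (3 + 1))) (unitK (sfStep Lc (m + 1)) (smStep 3 Lc (m + 1)) (KInvStep (d := 3) Lc (m + 1))) Lc (T m)
        - lin4 (cE₂ * (Lc : ℝ) ^ (2 * (3 + 1))) (unitK (sfStep Lc m) (smStep 3 Lc m) (KInvStep (d := 3) Lc m)) Lc (T m)) + (b (m + 1) - b m)) κ (u + (Lc : ℤ) • t) κ' (u' + (Lc : ℤ) • t)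
        = shiftK (-((Lc : ℤ) • t)) (((lin4 (cE₂ * (Lc : ℝ) ^ (2 * (3 + 1))) (unitK (sfStep Lc (m + 1)) (smStep 3 Lc (m + 1)) (KInvStep (d := 3) Lc (m + 1))) Lc (T m)
        - lin4 (cE₂ * (Lc : ℝ) ^ (2 * (3 + 1))) (unitK (sfStep Lc m) (smStep 3 Lc m) (KInvStep (d := 3) Lc m)) Lc (T m)) + (b (m + 1) - b m)) κ u κ' u')) ∧
      (∀ κ κ' κ₁ κ₂, zmode Lc ((lin4 (cE₂ * (Lc : ℝ) ^ (2 * (3 + 1))) (unitK (sfStep Lc (m + 1)) (smStep 3 Lc (m + 1)) (KInvStep (d := 3) Lc (m + 1))) Lc (T m)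
        - lin4 (cE₂ * (Lc : ℝ) ^ (2 * (3 + 1))) (unitK (sfStep Lc m) (smStep 3 Lc m) (KInvStep (d := 3) Lc m)) Lc (T m)) + (b (m + 1) - b m)) κ κ' (Sum.inl κ₁) (Sum.inl κ₂)
        + zmode Lc ((lin4 (cE₂ * (Lc : ℝ) ^ (2 * (3 + 1))) (unitK (sfStep Lc (m + 1)) (smStep 3 Lc (m + 1)) (KInvStep (d := 3) Lc (m + 1))) Lc (T m)
        - lin4 (cE₂ * (Lc : ℝ) ^ (2 * (3 + 1))) (unitK (sfStep Lc m) (smStep 3 Lc m) (KInvStep (d := 3) Lc m)) Lc (T m)) + (b (m + 1) - b m)) κ' κ (Sum.inl κ₁) (Sum.inl κ₂) = 0) :=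
    fun m => zfreeSym_forcing hLc1 (m + 1) m _ (hK (m + 1)) (hK m) hCK hδK (hT m) hδin (hTcov m) (hb m) (hb (m + 1)) hδin (hZ m) (hZ (m + 1))
  -- the first difference `D_0 = (𝒜_0 T_0 − T_0) + b_0`: shape, covariance, and ZERO symmetrised charge at the exact pin
  have hA0 := locStencil₂_lin4 (hK 0) hCK hδK hLc1 (cE₂ * (Lc : ℝ) ^ (2 * (3 + 1))) (hT 0) hδin
  set r : ℝ := min δK δin / 128 with hr_def
  have hr : 0 < r := by positivity
  have hrin : r ≤ δin := by
    rw [hr_def]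
    have := min_le_right δK δin
    linarith [hδin]
  have hT0r : LocStencil₂ (T 0) C₂ r := (hT 0).mono hrin
  have hP : LocStencil₂ (lin4 (cE₂ * (Lc : ℝ) ^ (2 * (3 + 1))) (unitK (sfStep Lc 0) (smStep 3 Lc 0) (KInvStep (d := 3) Lc 0)) Lc (T 0) - T 0) _ r :=
    locStencil₂_sub hA0 hT0r
  have hPcov : ∀ κ u κ' u' t, (lin4 (cE₂ * (Lc : ℝ) ^ (2 * (3 + 1))) (unitK (sfStep Lc 0) (smStep 3 Lc 0) (KInvStep (d := 3) Lc 0)) Lc (T 0) - T 0) κ (u + (Lc : ℤ) • t) κ' (u' + (Lc : ℤ) • t)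
      = shiftK (-((Lc : ℤ) • t)) ((lin4 (cE₂ * (Lc : ℝ) ^ (2 * (3 + 1))) (unitK (sfStep Lc 0) (smStep 3 Lc 0) (KInvStep (d := 3) Lc 0)) Lc (T 0) - T 0) κ u κ' u') :=
    fun κ u κ' u' t => sub_translate_pi (w := (Lc : ℤ) • t) (v := -((Lc : ℤ) • t))
      (fun κ u κ' u' => lin4_translate (shiftK_unitKInvStep 0) _ h0cov κ u κ' u' ((Lc : ℤ) • t)) (fun κ u κ' u' => h0cov κ u κ' u' t) κ u κ' u'
  have hPZ : ∀ κ κ' κ₁ κ₂, zmode Lc (lin4 (cE₂ * (Lc : ℝ) ^ (2 * (3 + 1))) (unitK (sfStep Lc 0) (smStep 3 Lc 0) (KInvStep (d := 3) Lc 0)) Lc (T 0) - T 0) κ κ' (Sum.inl κ₁) (Sum.inl κ₂)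
      + zmode Lc (lin4 (cE₂ * (Lc : ℝ) ^ (2 * (3 + 1))) (unitK (sfStep Lc 0) (smStep 3 Lc 0) (KInvStep (d := 3) Lc 0)) Lc (T 0) - T 0) κ' κ (Sum.inl κ₁) (Sum.inl κ₂) = 0 := by
    intro κ κ' κ₁ κ₂
    have e1 := zmode_sub (N := Lc) (hA0.mono le_rfl) hT0r hr κ κ' (Sum.inl κ₁) (Sum.inl κ₂)
    have e2 := zmode_sub (N := Lc) (hA0.mono le_rfl) hT0r hr κ' κ (Sum.inl κ₁) (Sum.inl κ₂)
    have hcons := zsym_lin4_step_of_pinEq hLc1 hpinEq 0 (hT 0) hδin h0cov κ κ' κ₁ κ₂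
    have e1' : zmode Lc (lin4 (cE₂ * (Lc : ℝ) ^ (2 * (3 + 1))) (unitK (sfStep Lc 0) (smStep 3 Lc 0) (KInvStep (d := 3) Lc 0)) Lc (T 0) - T 0) κ κ' (Sum.inl κ₁) (Sum.inl κ₂)
        = _ := e1
    have e2' : zmode Lc (lin4 (cE₂ * (Lc : ℝ) ^ (2 * (3 + 1))) (unitK (sfStep Lc 0) (smStep 3 Lc 0) (KInvStep (d := 3) Lc 0)) Lc (T 0) - T 0) κ' κ (Sum.inl κ₁) (Sum.inl κ₂)
        = _ := e2
    rw [e1', e2']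
    linarith
  have hD0Z := zfreeSym_add hP ((hb 0).mono hrin) hr ⟨hPcov, hPZ⟩ (hZ 0)
  have hD0eq : (fun κ u κ' u' => T (0 + 1) κ u κ' u' - T 0 κ u κ' u') =
      (lin4 (cE₂ * (Lc : ℝ) ^ (2 * (3 + 1))) (unitK (sfStep Lc 0) (smStep 3 Lc 0) (KInvStep (d := 3) Lc 0)) Lc (T 0) - T 0) + b 0 := by
    funext κ u κ' u'
    rw [Nat.zero_add, hstep 0]
    simp only [Pi.add_apply, Pi.sub_apply]
    abel
  -- the transport rows at the common input rate
  set δ0 : ℝ := min δf r with hδ0_def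
  have hδ0 : 0 < δ0 := lt_min hδf hr
  obtain ⟨CT, CT', δT, -, hCT', hδT, -, -, hTi⟩ := transport_rows_three_symZ hLc1 hK hδK cE₂ hδ0 (fun _ => (0 : ℝ))
  -- the difference tower unrolled from `D_0` through the SHIFTED transport
  have hbdd : ∀ n, ∃ B : ℝ, ∀ κ u κ' u' x z a b', |T n κ u κ' u' x z a b'| ≤ B := fun n => bdd₄_of_locStencil₂ (hT n) hδin.le
  have hsplit := fun n => diff_eq_transport_add_sum
    (A := fun j => lin4 (cE₂ * (Lc : ℝ) ^ (2 * (3 + 1))) (unitK (sfStep Lc j) (smStep 3 Lc j) (KInvStep (d := 3) Lc j)) Lc)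
    (P := fun X : BiTab 3 => ∃ B : ℝ, ∀ κ u κ' u' x z a b', |X κ u κ' u' x z a b'| ≤ B) (x := T) (b := b)
    bdd₄_zero (fun X Y hX hY => bdd₄_add hX hY) (fun X Y hX hY => bdd₄_sub hX hY) (fun j X hX => lin4_bdd₄ (cE₂ := cE₂) j X hX)
    (fun j X Y hX hY => lin4_add_bdd₄ (cE₂ := cE₂) j X Y hX hY) (hbdd 0) (fun j => bdd₄_of_locStencil₂ (hb j) hδin.le) hstep n
  -- END #2 of road W3 on the difference tower
  obtain ⟨c, ϑ, hc, hϑ0, hϑ1, hD⟩ := rate_of_rows (d := 3) (fun n => fun κ u κ' u' => T (n + 1) κ u κ' u' - T n κ u κ' u')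
    (fun m => (lin4 (cE₂ * (Lc : ℝ) ^ (2 * (3 + 1))) (unitK (sfStep Lc (m + 1)) (smStep 3 Lc (m + 1)) (KInvStep (d := 3) Lc (m + 1))) Lc (T m)
        - lin4 (cE₂ * (Lc : ℝ) ^ (2 * (3 + 1))) (unitK (sfStep Lc m) (smStep 3 Lc m) (KInvStep (d := 3) Lc m)) Lc (T m)) + (b (m + 1) - b m))
    (fun m k => transport (fun j => lin4 (cE₂ * (Lc : ℝ) ^ (2 * (3 + 1))) (unitK (sfStep Lc j) (smStep 3 Lc j) (KInvStep (d := 3) Lc j)) Lc) (m + 1) k)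
    (fun X : BiTab 3 => (∀ κ u κ' u' t, X κ (u + (Lc : ℤ) • t) κ' (u' + (Lc : ℤ) • t) = shiftK (-((Lc : ℤ) • t)) (X κ u κ' u')) ∧
      (∀ κ κ' κ₁ κ₂, zmode Lc X κ κ' (Sum.inl κ₁) (Sum.inl κ₂) + zmode Lc X κ' κ (Sum.inl κ₁) (Sum.inl κ₂) = 0))
    (fun _ => (0 : ℝ)) hCT' inv_natCast_nonneg (inv_natCast_lt_one hLc) hθf0 hθf1
    (fun n => by
      have h := hsplit n
      have e : (fun κ u κ' u' => T (n + 1) κ u κ' u' - T n κ u κ' u') = T (n + 1) - T n := rfl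
      have e0 : (fun κ u κ' u' => T (0 + 1) κ u κ' u' - T 0 κ u κ' u') = T 1 - T 0 := rfl
      rw [e, e0, h])
    (fun m k X C hC hX hZX hm => hTi hpin (m + 1) k X C hC hX hZX hm)
    (fun m => ⟨(hf m).mono (min_le_left _ _), by positivity⟩) hZf
    ⟨by rw [hD0eq]; exact (locStencil₂_add hP ((hb 0).mono hrin)).mono (min_le_right _ _), by
      have := (locStencil₂_add hP ((hb 0).mono hrin)).nonneg; linarith⟩
    (by rw [hD0eq]; exact hD0Z)
  exact ⟨c, ϑ, δT, hc, hϑ0, hϑ1, hδT, hD, fun k j => cauchy_of_rate T hc hϑ0.le hϑ1 hD k j⟩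

end Summit.QuantumFields.BalabanUV.Beta.GAN24.T2HybridDriftEnd

end
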